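/-
Copyright (c) 2026 the pub-hodgecm-mathlib formalisation cell (harness21).  Prover seat hodgecm-mathlib-R90-C133-p02 (g2), Track B ∕ R90-TF, h413 = `stmt-HodgeConjecture-24833`,
R90-TF section S8 «ContSpec-n½» (S8 dealer R90-CS-plan (g3) S8-R221: «C133-p02: finish `hTRANSτ` OF RECORD (A ★ + B ★ + T exports by name)»): `hTRANSτ` ∕ `hDISC` OF RECORD IN
ESTATE T'S CURRENCY — the interim letter `hEXI` of ★ p864527 (★ D1's continuation data for every continuous `K_∞`-finite τ-level pair-section) is discharged from THREE per-section ROWS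
in ESTATE T's own shapes: the EXPORTS row `hTEXPnf` (K2E1-p11 (g5)'s `hTEXP` of ★ `R90S8ResGMidRowsOfTauExportsU3` §2 plus the normal-form clause of the same ★ head — ★ at blocks, §3),
the POLE-LEDGER row `hPL` ((MS-P′) + (MS-3∕2) for any continuation, [MW95 IV.1.11]) and the RESIDUE row `hRES` (the residue at `3∕2` is square-integrable, [MW95 I.4.11, V.3.13]); the pole
ledger's rows are ★ p863972 `chiEisenstein_poleLedger_rows_cm_three_of_letters` (K2E2-p12).
-/
import Summits.HodgeConjecture.HodgeConjecture.Theorems.R90S8ResGMidAtomTransFiniteOfExportsU3   -- ★ p864527 (this seat): `hTRANSτ_of_exports_of_arch`, `hDISC_of_exports_of_arch` (+ ★ FILE A ∕ B, ★ p864333)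
import Summits.HodgeConjecture.HodgeConjecture.Theorems.R90S8ResGMidRowsOfTauExportsU3           -- ★ p864446 (K2E1-p11 (g5)): the `hTEXP` row shape; brings ★ p864350 T head, ★ p863972 pole-ledger rows, ★ τ-DEFS
import HarnessLib

/-!
# S8 (R)′ road — `R90S8ResGMidAtomTransOfRecordU3`: `hTRANSτ` ∕ `hDISC` OF RECORD — the exports letter `hEXI` FROM ESTATE T's ROWS {`hTEXPnf`, `hPL`, `hRES`} BY NAME

Track B ∕ R90-TF, crux h413 = `stmt-HodgeConjecture-24833`, route of record `HCCMUnconditional`; cell `hodgecm-mathlib`, R90-TF section S8 «ContSpec-n½ ∕ ResidualSpectrum», socket (R)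
(B ED. 7 :337) ← ★ `res_midBlock_le_residual_of_letters' (hDISC) …` ← ★ p864333 ← ★ p864527 `hDISC_of_exports_of_arch (hW1) (hEXI) (hARCH)` ← THIS FILE `hEXI_of_rows (hTEXPnf) (hPL) (hRES)`.
THEOREMS ONLY (no `def`, no `instance`, no `notation`, no named-fact hypothesis, no `sorry`; default heartbeats); lane `--supports stmt-HodgeConjecture-24833 --as helper` (count-neutral).
CLOSES NO SOCKET (OF-RECORD ≠ payment).

THE THREE ROWS (per τ-admissible `(U₀, φ)`: `IsTauLevel U₀`, `φ ∈ V(χ₁, χ₂; ι_f(U₀), 1)` continuous, `IsArchFinite φ` — the common head of K2E1-p11's `hTEXP`):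
* `hTEXPnf` — SOME continuation `Ec′` of `z ↦ E(flat(φ, z))` in MEROMORPHIC NORMAL FORM with a closed co-discrete pole set `P ⊆ {Re ≤ 2}`, analyticity, (E4), (E2-bd) off `P`: `hTEXP`'s bytes with
  the head's clause `∀ g, MeromorphicNFOn (Ec′ · g) univ` kept (§3: ★ `chiEisenstein_meromorphic_exports_kfinite_cm_three_of_gauge_letters` at the block, exactly as p11's §3).
* `hPL` — for any such continuation: joint boundedness near every candidate pole of `{1 < Re}` off `3∕2` ((MS-P′): no pole there) and `(z − 3∕2)·Ec` bounded near `3∕2` ((MS-3∕2): at most a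
  simple pole) — the bytes of ★ p863972's `hbddPK` ∕ `hbdd32` [MW95 IV.1.11; Arthur, intertwining operators]; OWNER: ESTATE T's Maass–Selberg column (★ for the named witness family via
  `ledgerLetters_of_exports`, letters at general K-finite sections).
* `hRES` — for the continued family on the slit plane `{1 < Re} ∖ {3∕2}` and its pole letter `Fp` at `3∕2`: the residue function `x ↦ Fp((out x)⁻¹)(3∕2)` on `G(F)∖G(𝔸)` is a.e. an `L²`
  class [MW95 I.4.11, V.3.13]; OWNER: ESTATE T's (E6)∕hCONT column.
THE MATHEMATICS OF §1: ★ p863972 turns (`hTEXPnf`, `hPL`) into ★ D1's continuation rows with `Sp := {3∕2}` and a pole letter `Fp`; `hRES` supplies the class; that is `hEXI`.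
* §1 **`hEXI_of_rows (hTEXPnf) (hPL) (hRES)`** (any pair `(χ₁, χ₂)`) ⊢ ★ p864527's `hEXI` BYTE FOR BYTE.
* §2 **`hTRANSτ_of_rows_of_arch (hμu) (hTEXPnf) (hPL) (hRES) (harch)`**, **`hDISC_of_rows_of_arch (hW1) (hTEXPnf) (hPL) (hRES) (hARCH)`** (∀-closed; conclusion = `hDISC` bytes VERBATIM).
* §3 **`exportsTauRowNF_of_gauge_blocks (hBLOCK)`** — `hTEXPnf` at the exports' frame from p11's BLOCK LETTER `hBLOCK` (bytes of ★ `exportsTauRow_of_gauge_blocks`), ★ T head at the block.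
THE LEDGER after this file: `hDISC` = ★ ∘ {`hW1` (K2E1-p10), `hTEXPnf` (★ at blocks modulo `hBLOCK` = τ-ports + K2E1-p12's laws), `hPL` (T's MS column), `hRES` (T's residue column),
`hARCH` = (T_∞) (L)}.
HONEST LABEL: HC_CM is proved only modulo the 7 printed citations (2 remaining named inputs: hLiu418 = `stmt-HodgeConjecture-24832`, h413 = `stmt-HodgeConjecture-24833`) until
rung 0 closes; REL ≠ ★ ≠ BUILT; OF-RECORD ≠ payment; pays no socket; count-neutral.

## References
* [MoeglinWaldspurger1995] C. Mœglin, J.-L. Waldspurger, *Spectral Decomposition and Eisenstein Series* (1995), I.4.11, II.1.5, IV.1.9–IV.1.11, V.3.13.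
* [BernsteinLapid2019] J. Bernstein, E. Lapid, *On the meromorphic continuation of Eisenstein series*, J. Amer. Math. Soc. 37 (2024), Thm 2.3, §4, §7.
* [BorelJacquet1979] A. Borel, H. Jacquet, *Automorphic forms and automorphic representations*, Proc. Symp. Pure Math. 33.1 (1979), §4.1, §4.6.
-/

set_option autoImplicit false
set_option linter.dupNamespace false  -- the mandated namespace `…HodgeConjecture.HodgeConjecture.R90.S8` (LEAD #1 L1) repeats the summit's segment

noncomputable section

open MeasureTheory Measure Set Filter Topology NumberField IsDedekindDomain ContRepresentation
open Literature.MeasureTheory.Group Literature.NumberTheory Literature.NumberTheory.Automorphic Literature.NumberTheory.Automorphic.UnitaryGroup Literature.NumberTheory.GaloisRepresentations AdelicGroupData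
open Literature.NumberTheory.Automorphic.Arthur2013.Leaves.TECR Literature.NumberTheory.Rogawski1990
open Summit.HodgeConjecture.HodgeConjecture.Cruxes.H413.K2E1BorelEisensteinU
open Summit.HodgeConjecture.HodgeConjecture.Cruxes.H413.K2E1CharacterEisensteinU3PairDefs
open Summit.HodgeConjecture.HodgeConjecture.Cruxes.H413.K2E1ChiSectionSpaceU3PairDefs
open Summit.HodgeConjecture.HodgeConjecture.Cruxes.H413.K2E1BLBorelSpacesU2Defs Summit.HodgeConjecture.HodgeConjecture.Cruxes.H413.K2E1BLBorelOperatorsU2Defs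
open Summit.HodgeConjecture.HodgeConjecture.Cruxes.H413.K2E1ChiEisensteinPoleLedgerCMThree (chiEisenstein_poleLedger_rows_cm_three_of_letters)
open Summit.HodgeConjecture.HodgeConjecture.Cruxes.H413.K2E1ChiEisensteinMeromorphicExportsKFiniteCMThree (chiEisenstein_meromorphic_exports_kfinite_cm_three_of_gauge_letters)
open scoped ENNReal NNReal

namespace Summit.HodgeConjecture.HodgeConjecture.R90.S8

variable (L : Type) [Field L] [NumberField L] [IsCMField L]

/-! ## §1 `hEXI` from the three rows -/

/-- **★ p864527's `hEXI` FROM ESTATE T's THREE ROWS** (any pair `(χ₁, χ₂)`): the exports row in normal form `hTEXPnf`, the pole-ledger row `hPL` and the residue row `hRES` give, for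
every continuous `K_∞`-finite τ-level pair-section `ψ`, ★ D1's continuation data with `Sp := {3∕2}` (★ `chiEisenstein_poleLedger_rows_cm_three_of_letters`) and an `L²` residue class.
[cite: MoeglinWaldspurger1995, IV.1.9–IV.1.11, V.3.13] [cite: BernsteinLapid2019, Thm 2.3, §4] -/
theorem hEXI_of_rows (μ : Measure (quasiSplit (↥(maximalRealSubfield L)) L (IsCMField.complexConj L) 3).automorphicQuotient) {χ₁ : HeckeCharacter L} {χ₂ : ↥(TorusDict.torus (IsCMField.complexConj L)) →ₜ* ℂˣ}
    (hTEXPnf : ∀ (U₀ : Subgroup ↥(finAdelic (↥(maximalRealSubfield L)) L (IsCMField.complexConj L) 3 ((StdForm.antidiagonal 3).over L))) (_ : IsTauLevel L U₀)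
      (φ : (quasiSplit (↥(maximalRealSubfield L)) L (IsCMField.complexConj L) 3).Adelic → ℂ) (_ : φ ∈ chiSectionSpacePair χ₁ χ₂ (tauLevel L U₀) ((1 : ↥(tauLevel L U₀) →* ℂ) : ↥(tauLevel L U₀) → ℂ)) (_ : Continuous φ)
      (_ : IsArchFinite L φ),
      ∃ (Ec' : ℂ → (quasiSplit (↥(maximalRealSubfield L)) L (IsCMField.complexConj L) 3).Adelic → ℂ) (P : Set ℂ), (∀ g, MeromorphicNFOn (fun z => Ec' z g) univ) ∧ IsClosed P ∧ (∀ z₀ : ℂ, ∀ᶠ s in 𝓝[≠] z₀, s ∉ P) ∧ (∀ z ∈ P, z.re ≤ 2) ∧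
        (∀ z : ℂ, 2 < z.re → Ec' z = eisensteinSeriesU (flatSectionU φ z)) ∧ (∀ g (z : ℂ), z ∉ P → AnalyticAt ℂ (fun z => Ec' z g) z) ∧
        (∀ z : ℂ, z ∉ P → Continuous (Ec' z)) ∧
        (∀ z₁ : ℂ, z₁ ∉ P → ∀ K : Set (quasiSplit (↥(maximalRealSubfield L)) L (IsCMField.complexConj L) 3).Adelic, IsCompact K → ∃ V ∈ 𝓝 z₁, ∃ M : ℝ, ∀ z ∈ V, ∀ g ∈ K, ‖Ec' z g‖ ≤ M))
    (hPL : ∀ (U₀ : Subgroup ↥(finAdelic (↥(maximalRealSubfield L)) L (IsCMField.complexConj L) 3 ((StdForm.antidiagonal 3).over L))) (_ : IsTauLevel L U₀)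
      (φ : (quasiSplit (↥(maximalRealSubfield L)) L (IsCMField.complexConj L) 3).Adelic → ℂ) (_ : φ ∈ chiSectionSpacePair χ₁ χ₂ (tauLevel L U₀) ((1 : ↥(tauLevel L U₀) →* ℂ) : ↥(tauLevel L U₀) → ℂ)) (_ : Continuous φ)
      (_ : IsArchFinite L φ)
      (Ec : ℂ → (quasiSplit (↥(maximalRealSubfield L)) L (IsCMField.complexConj L) 3).Adelic → ℂ) (P : Set ℂ), (∀ z : ℂ, 2 < z.re → Ec z = eisensteinSeriesU (flatSectionU φ z)) →
      (∀ z₀ : ℂ, ∀ᶠ s in 𝓝[≠] z₀, s ∉ P) → (∀ g (z : ℂ), z ∉ P → AnalyticAt ℂ (fun z => Ec z g) z) →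
      (∀ z₀ ∈ P, 1 < z₀.re → z₀ ≠ (3 : ℂ) / 2 → ∀ K : Set (quasiSplit (↥(maximalRealSubfield L)) L (IsCMField.complexConj L) 3).Adelic, IsCompact K → ∃ C : ℝ, ∀ᶠ z in 𝓝[≠] z₀, ∀ g ∈ K, ‖Ec z g‖ ≤ C) ∧
      (∀ g, ∃ C : ℝ, ∀ᶠ z in 𝓝[≠] ((3 : ℂ) / 2), ‖(z - (3 : ℂ) / 2) * Ec z g‖ ≤ C))
    (hRES : ∀ (U₀ : Subgroup ↥(finAdelic (↥(maximalRealSubfield L)) L (IsCMField.complexConj L) 3 ((StdForm.antidiagonal 3).over L))) (_ : IsTauLevel L U₀)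
      (φ : (quasiSplit (↥(maximalRealSubfield L)) L (IsCMField.complexConj L) 3).Adelic → ℂ) (_ : φ ∈ chiSectionSpacePair χ₁ χ₂ (tauLevel L U₀) ((1 : ↥(tauLevel L U₀) →* ℂ) : ↥(tauLevel L U₀) → ℂ)) (_ : Continuous φ)
      (_ : IsArchFinite L φ)
      (Ec : ℂ → (quasiSplit (↥(maximalRealSubfield L)) L (IsCMField.complexConj L) 3).Adelic → ℂ), (∀ z : ℂ, 2 < z.re → Ec z = eisensteinSeriesU (flatSectionU φ z)) →
      (∀ g, DifferentiableOn ℂ (fun z => Ec z g) ({z : ℂ | 1 < z.re} \ (↑({(3 : ℂ) / 2} : Finset ℂ) : Set ℂ))) →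
      ∀ (Fp : (quasiSplit (↥(maximalRealSubfield L)) L (IsCMField.complexConj L) 3).Adelic → ℂ → ℂ), (∀ g, AnalyticAt ℂ (Fp g) ((3 : ℂ) / 2)) → (∀ g, Fp g =ᶠ[𝓝[≠] ((3 : ℂ) / 2)] fun z => (z - (3 : ℂ) / 2) * Ec z g) →
      ∃ f : (quasiSplit (↥(maximalRealSubfield L)) L (IsCMField.complexConj L) 3).L2 μ, (f : (quasiSplit (↥(maximalRealSubfield L)) L (IsCMField.complexConj L) 3).automorphicQuotient → ℂ) =ᵐ[μ] fun x => Fp (Quotient.out (x : (quasiSplit (↥(maximalRealSubfield L)) L (IsCMField.complexConj L) 3).Adelic ⧸ (quasiSplit (↥(maximalRealSubfield L)) L (IsCMField.complexConj L) 3).quotientSubgroup))⁻¹ ((3 : ℂ) / 2)) :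
    ∀ (U₁ : Subgroup ↥(finAdelic (↥(maximalRealSubfield L)) L (IsCMField.complexConj L) 3 ((StdForm.antidiagonal 3).over L))), IsTauLevel L U₁ → ∀ (ψ : (quasiSplit (↥(maximalRealSubfield L)) L (IsCMField.complexConj L) 3).Adelic → ℂ),
      ψ ∈ chiSectionSpacePair χ₁ χ₂ (tauLevel L U₁) ((1 : ↥(tauLevel L U₁) →* ℂ) : ↥(tauLevel L U₁) → ℂ) → Continuous ψ → IsArchFinite L ψ →
      ∃ (Ec : ℂ → (quasiSplit (↥(maximalRealSubfield L)) L (IsCMField.complexConj L) 3).Adelic → ℂ) (Sp : Finset ℂ) (_ : ∀ s ∈ Sp, s.im = 0 ∧ 1 < s.re ∧ s.re ≤ 2)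
        (_ : ∀ g, DifferentiableOn ℂ (fun z => Ec z g) ({z : ℂ | 1 < z.re} \ (↑Sp : Set ℂ))) (_ : ∀ z : ℂ, 2 < z.re → Ec z = eisensteinSeriesU (flatSectionU ψ z))
        (Fp : (quasiSplit (↥(maximalRealSubfield L)) L (IsCMField.complexConj L) 3).Adelic → ℂ → ℂ) (_ : ∀ g, AnalyticAt ℂ (Fp g) ((3 : ℂ) / 2)) (_ : ∀ g, Fp g =ᶠ[𝓝[≠] ((3 : ℂ) / 2)] fun z => (z - (3 : ℂ) / 2) * Ec z g)
        (f : (quasiSplit (↥(maximalRealSubfield L)) L (IsCMField.complexConj L) 3).L2 μ), (f : (quasiSplit (↥(maximalRealSubfield L)) L (IsCMField.complexConj L) 3).automorphicQuotient → ℂ) =ᵐ[μ] fun x => Fp (Quotient.out (x : (quasiSplit (↥(maximalRealSubfield L)) L (IsCMField.complexConj L) 3).Adelic ⧸ (quasiSplit (↥(maximalRealSubfield L)) L (IsCMField.complexConj L) 3).quotientSubgroup))⁻¹ ((3 : ℂ) / 2) := by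
  intro U₁ hU₁ ψ hψ hψc hψa
  obtain ⟨Ec, P, hEnf, -, hPcd, -, hEcE, hEan, hE4, hEbd⟩ := hTEXPnf U₁ hU₁ ψ hψ hψc hψa
  obtain ⟨hbddPK, hbdd32⟩ := hPL U₁ hU₁ ψ hψ hψc hψa Ec P hEcE hPcd hEan
  obtain ⟨hSp, hEd, -, -, Fp, hF, hFE⟩ := chiEisenstein_poleLedger_rows_cm_three_of_letters L Ec P hEnf hPcd hEan hE4 hEbd hbddPK hbdd32
  obtain ⟨f, hae⟩ := hRES U₁ hU₁ ψ hψ hψc hψa Ec hEcE hEd Fp hF hFE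
  exact ⟨Ec, {(3 : ℂ) / 2}, hSp, hEd, hEcE, Fp, hF, hFE, f, hae⟩

/-! ## §2 `hTRANSτ` and `hDISC` of record from the rows -/

section Main

variable (μ : Measure (quasiSplit (↥(maximalRealSubfield L)) L (IsCMField.complexConj L) 3).automorphicQuotient) [(quasiSplit (↥(maximalRealSubfield L)) L (IsCMField.complexConj L) 3).IsAutomorphicMeasure μ] (ξ : OneDimAutRepH L) (μω : HeckeCharacter L)

/-- **`hTRANSτ` FOR ONE `(L, μ, ξ, μω)` FROM THE ROWS AND (T_∞)** (`μω` unitary): ★ `hTRANSτ_of_exports_of_arch` ∘ §1. [cite: MoeglinWaldspurger1995, II.1.5, IV.1.11, V.3.13]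
[cite: BorelJacquet1979, §4.1] -/
theorem hTRANSτ_of_rows_of_arch (hμu : μω.IsUnitary)
    (hTEXPnf : ∀ (U₀ : Subgroup ↥(finAdelic (↥(maximalRealSubfield L)) L (IsCMField.complexConj L) 3 ((StdForm.antidiagonal 3).over L))) (_ : IsTauLevel L U₀)
      (φ : (quasiSplit (↥(maximalRealSubfield L)) L (IsCMField.complexConj L) 3).Adelic → ℂ) (_ : φ ∈ chiSectionSpacePair (ξ.bcη⁻¹ * ξ.bcψ⁻¹ * μω) ξ.ψ (tauLevel L U₀) ((1 : ↥(tauLevel L U₀) →* ℂ) : ↥(tauLevel L U₀) → ℂ)) (_ : Continuous φ)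
      (_ : IsArchFinite L φ),
      ∃ (Ec' : ℂ → (quasiSplit (↥(maximalRealSubfield L)) L (IsCMField.complexConj L) 3).Adelic → ℂ) (P : Set ℂ), (∀ g, MeromorphicNFOn (fun z => Ec' z g) univ) ∧ IsClosed P ∧ (∀ z₀ : ℂ, ∀ᶠ s in 𝓝[≠] z₀, s ∉ P) ∧ (∀ z ∈ P, z.re ≤ 2) ∧
        (∀ z : ℂ, 2 < z.re → Ec' z = eisensteinSeriesU (flatSectionU φ z)) ∧ (∀ g (z : ℂ), z ∉ P → AnalyticAt ℂ (fun z => Ec' z g) z) ∧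
        (∀ z : ℂ, z ∉ P → Continuous (Ec' z)) ∧
        (∀ z₁ : ℂ, z₁ ∉ P → ∀ K : Set (quasiSplit (↥(maximalRealSubfield L)) L (IsCMField.complexConj L) 3).Adelic, IsCompact K → ∃ V ∈ 𝓝 z₁, ∃ M : ℝ, ∀ z ∈ V, ∀ g ∈ K, ‖Ec' z g‖ ≤ M))
    (hPL : ∀ (U₀ : Subgroup ↥(finAdelic (↥(maximalRealSubfield L)) L (IsCMField.complexConj L) 3 ((StdForm.antidiagonal 3).over L))) (_ : IsTauLevel L U₀)
      (φ : (quasiSplit (↥(maximalRealSubfield L)) L (IsCMField.complexConj L) 3).Adelic → ℂ) (_ : φ ∈ chiSectionSpacePair (ξ.bcη⁻¹ * ξ.bcψ⁻¹ * μω) ξ.ψ (tauLevel L U₀) ((1 : ↥(tauLevel L U₀) →* ℂ) : ↥(tauLevel L U₀) → ℂ)) (_ : Continuous φ)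
      (_ : IsArchFinite L φ)
      (Ec : ℂ → (quasiSplit (↥(maximalRealSubfield L)) L (IsCMField.complexConj L) 3).Adelic → ℂ) (P : Set ℂ), (∀ z : ℂ, 2 < z.re → Ec z = eisensteinSeriesU (flatSectionU φ z)) →
      (∀ z₀ : ℂ, ∀ᶠ s in 𝓝[≠] z₀, s ∉ P) → (∀ g (z : ℂ), z ∉ P → AnalyticAt ℂ (fun z => Ec z g) z) →
      (∀ z₀ ∈ P, 1 < z₀.re → z₀ ≠ (3 : ℂ) / 2 → ∀ K : Set (quasiSplit (↥(maximalRealSubfield L)) L (IsCMField.complexConj L) 3).Adelic, IsCompact K → ∃ C : ℝ, ∀ᶠ z in 𝓝[≠] z₀, ∀ g ∈ K, ‖Ec z g‖ ≤ C) ∧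
      (∀ g, ∃ C : ℝ, ∀ᶠ z in 𝓝[≠] ((3 : ℂ) / 2), ‖(z - (3 : ℂ) / 2) * Ec z g‖ ≤ C))
    (hRES : ∀ (U₀ : Subgroup ↥(finAdelic (↥(maximalRealSubfield L)) L (IsCMField.complexConj L) 3 ((StdForm.antidiagonal 3).over L))) (_ : IsTauLevel L U₀)
      (φ : (quasiSplit (↥(maximalRealSubfield L)) L (IsCMField.complexConj L) 3).Adelic → ℂ) (_ : φ ∈ chiSectionSpacePair (ξ.bcη⁻¹ * ξ.bcψ⁻¹ * μω) ξ.ψ (tauLevel L U₀) ((1 : ↥(tauLevel L U₀) →* ℂ) : ↥(tauLevel L U₀) → ℂ)) (_ : Continuous φ)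
      (_ : IsArchFinite L φ)
      (Ec : ℂ → (quasiSplit (↥(maximalRealSubfield L)) L (IsCMField.complexConj L) 3).Adelic → ℂ), (∀ z : ℂ, 2 < z.re → Ec z = eisensteinSeriesU (flatSectionU φ z)) →
      (∀ g, DifferentiableOn ℂ (fun z => Ec z g) ({z : ℂ | 1 < z.re} \ (↑({(3 : ℂ) / 2} : Finset ℂ) : Set ℂ))) →
      ∀ (Fp : (quasiSplit (↥(maximalRealSubfield L)) L (IsCMField.complexConj L) 3).Adelic → ℂ → ℂ), (∀ g, AnalyticAt ℂ (Fp g) ((3 : ℂ) / 2)) → (∀ g, Fp g =ᶠ[𝓝[≠] ((3 : ℂ) / 2)] fun z => (z - (3 : ℂ) / 2) * Ec z g) →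
      ∃ f : (quasiSplit (↥(maximalRealSubfield L)) L (IsCMField.complexConj L) 3).L2 μ, (f : (quasiSplit (↥(maximalRealSubfield L)) L (IsCMField.complexConj L) 3).automorphicQuotient → ℂ) =ᵐ[μ] fun x => Fp (Quotient.out (x : (quasiSplit (↥(maximalRealSubfield L)) L (IsCMField.complexConj L) 3).Adelic ⧸ (quasiSplit (↥(maximalRealSubfield L)) L (IsCMField.complexConj L) 3).quotientSubgroup))⁻¹ ((3 : ℂ) / 2))
    (harch : ∀ (U₀ : Subgroup ↥(finAdelic (↥(maximalRealSubfield L)) L (IsCMField.complexConj L) 3 ((StdForm.antidiagonal 3).over L))), IsTauLevel L U₀ → ∀ f ∈ resGMidAtomGenτ L μ ξ μω U₀, ∀ a : ↥(arch (↥(maximalRealSubfield L)) L (IsCMField.complexConj L) 3 ((StdForm.antidiagonal 3).over L)),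
        ((quasiSplit (↥(maximalRealSubfield L)) L (IsCMField.complexConj L) 3).rightRegular μ) (archToAdelic (↥(maximalRealSubfield L)) L (IsCMField.complexConj L) 3 ((StdForm.antidiagonal 3).over L) a) f ∈ (Submodule.span ℂ (⋃ (U₀ : Subgroup ↥(finAdelic (↥(maximalRealSubfield L)) L (IsCMField.complexConj L) 3 ((StdForm.antidiagonal 3).over L))) (_ : IsTauLevel L U₀), resGMidAtomGenτ L μ ξ μω U₀)).topologicalClosure) :
    ∀ g : (quasiSplit (↥(maximalRealSubfield L)) L (IsCMField.complexConj L) 3).Adelic, ∀ f ∈ (⋃ (U₀ : Subgroup ↥(finAdelic (↥(maximalRealSubfield L)) L (IsCMField.complexConj L) 3 ((StdForm.antidiagonal 3).over L))) (_ : IsTauLevel L U₀), resGMidAtomGenτ L μ ξ μω U₀),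
      ((quasiSplit (↥(maximalRealSubfield L)) L (IsCMField.complexConj L) 3).rightRegular μ) g f ∈ (Submodule.span ℂ (⋃ (U₀ : Subgroup ↥(finAdelic (↥(maximalRealSubfield L)) L (IsCMField.complexConj L) 3 ((StdForm.antidiagonal 3).over L))) (_ : IsTauLevel L U₀), resGMidAtomGenτ L μ ξ μω U₀)).topologicalClosure :=
  hTRANSτ_of_exports_of_arch L μ ξ μω hμu (hEXI_of_rows L μ hTEXPnf hPL hRES) harch

end Main

/-- **`hDISC` OF RECORD FROM {`hW1`, `hTEXPnf`, `hPL`, `hRES`, `hARCH`}** — conclusion = the `hDISC` binder bytes of ★ `res_midBlock_le_residual_of_letters'` VERBATIM (as in ★ p864333 ∕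
★ p864527); hypotheses ∀-closed in the same frame: `hW1` (density of the K-finite residues, K2E1-p10), ESTATE T's three rows, and `hARCH` = (T_∞).  THE LEDGER: `hDISC` = ★ p864527 ∘ ★ §1 ∘
{`hW1`, `hTEXPnf`, `hPL`, `hRES`, `hARCH`}. [cite: MoeglinWaldspurger1995, I.2.17–I.2.18, IV.1.11, V.3.13] [cite: Rogawski1990, §13.9 p. 229 (ii)] -/
theorem hDISC_of_rows_of_arch
    (hW1 : ∀ (L : Type) [Field L] [NumberField L] [IsCMField L]
      (μ : Measure (quasiSplit (↥(maximalRealSubfield L)) L (IsCMField.complexConj L) 3).automorphicQuotient) [(quasiSplit (↥(maximalRealSubfield L)) L (IsCMField.complexConj L) 3).IsAutomorphicMeasure μ]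
      (μω : HeckeCharacter L) (_ : μω.IsUnitary) (ξ : OneDimAutRepH L), resGMidBlock L μ ξ μω ≤ resGMidBlockτ L μ ξ μω)
    (hTEXPnf : ∀ (L : Type) [Field L] [NumberField L] [IsCMField L]
      (μ : Measure (quasiSplit (↥(maximalRealSubfield L)) L (IsCMField.complexConj L) 3).automorphicQuotient) [(quasiSplit (↥(maximalRealSubfield L)) L (IsCMField.complexConj L) 3).IsAutomorphicMeasure μ]
      (μω : HeckeCharacter L) (_ : μω.IsUnitary) (ξ : OneDimAutRepH L), 
      ∀ (U₀ : Subgroup ↥(finAdelic (↥(maximalRealSubfield L)) L (IsCMField.complexConj L) 3 ((StdForm.antidiagonal 3).over L))) (_ : IsTauLevel L U₀)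
        (φ : (quasiSplit (↥(maximalRealSubfield L)) L (IsCMField.complexConj L) 3).Adelic → ℂ) (_ : φ ∈ chiSectionSpacePair (ξ.bcη⁻¹ * ξ.bcψ⁻¹ * μω) ξ.ψ (tauLevel L U₀) ((1 : ↥(tauLevel L U₀) →* ℂ) : ↥(tauLevel L U₀) → ℂ)) (_ : Continuous φ)
        (_ : IsArchFinite L φ),
        ∃ (Ec' : ℂ → (quasiSplit (↥(maximalRealSubfield L)) L (IsCMField.complexConj L) 3).Adelic → ℂ) (P : Set ℂ), (∀ g, MeromorphicNFOn (fun z => Ec' z g) univ) ∧ IsClosed P ∧ (∀ z₀ : ℂ, ∀ᶠ s in 𝓝[≠] z₀, s ∉ P) ∧ (∀ z ∈ P, z.re ≤ 2) ∧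
          (∀ z : ℂ, 2 < z.re → Ec' z = eisensteinSeriesU (flatSectionU φ z)) ∧ (∀ g (z : ℂ), z ∉ P → AnalyticAt ℂ (fun z => Ec' z g) z) ∧
          (∀ z : ℂ, z ∉ P → Continuous (Ec' z)) ∧
          (∀ z₁ : ℂ, z₁ ∉ P → ∀ K : Set (quasiSplit (↥(maximalRealSubfield L)) L (IsCMField.complexConj L) 3).Adelic, IsCompact K → ∃ V ∈ 𝓝 z₁, ∃ M : ℝ, ∀ z ∈ V, ∀ g ∈ K, ‖Ec' z g‖ ≤ M))
    (hPL : ∀ (L : Type) [Field L] [NumberField L] [IsCMField L]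
      (μ : Measure (quasiSplit (↥(maximalRealSubfield L)) L (IsCMField.complexConj L) 3).automorphicQuotient) [(quasiSplit (↥(maximalRealSubfield L)) L (IsCMField.complexConj L) 3).IsAutomorphicMeasure μ]
      (μω : HeckeCharacter L) (_ : μω.IsUnitary) (ξ : OneDimAutRepH L), 
      ∀ (U₀ : Subgroup ↥(finAdelic (↥(maximalRealSubfield L)) L (IsCMField.complexConj L) 3 ((StdForm.antidiagonal 3).over L))) (_ : IsTauLevel L U₀)
        (φ : (quasiSplit (↥(maximalRealSubfield L)) L (IsCMField.complexConj L) 3).Adelic → ℂ) (_ : φ ∈ chiSectionSpacePair (ξ.bcη⁻¹ * ξ.bcψ⁻¹ * μω) ξ.ψ (tauLevel L U₀) ((1 : ↥(tauLevel L U₀) →* ℂ) : ↥(tauLevel L U₀) → ℂ)) (_ : Continuous φ)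
        (_ : IsArchFinite L φ)
        (Ec : ℂ → (quasiSplit (↥(maximalRealSubfield L)) L (IsCMField.complexConj L) 3).Adelic → ℂ) (P : Set ℂ), (∀ z : ℂ, 2 < z.re → Ec z = eisensteinSeriesU (flatSectionU φ z)) →
        (∀ z₀ : ℂ, ∀ᶠ s in 𝓝[≠] z₀, s ∉ P) → (∀ g (z : ℂ), z ∉ P → AnalyticAt ℂ (fun z => Ec z g) z) →
        (∀ z₀ ∈ P, 1 < z₀.re → z₀ ≠ (3 : ℂ) / 2 → ∀ K : Set (quasiSplit (↥(maximalRealSubfield L)) L (IsCMField.complexConj L) 3).Adelic, IsCompact K → ∃ C : ℝ, ∀ᶠ z in 𝓝[≠] z₀, ∀ g ∈ K, ‖Ec z g‖ ≤ C) ∧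
        (∀ g, ∃ C : ℝ, ∀ᶠ z in 𝓝[≠] ((3 : ℂ) / 2), ‖(z - (3 : ℂ) / 2) * Ec z g‖ ≤ C))
    (hRES : ∀ (L : Type) [Field L] [NumberField L] [IsCMField L]
      (μ : Measure (quasiSplit (↥(maximalRealSubfield L)) L (IsCMField.complexConj L) 3).automorphicQuotient) [(quasiSplit (↥(maximalRealSubfield L)) L (IsCMField.complexConj L) 3).IsAutomorphicMeasure μ]
      (μω : HeckeCharacter L) (_ : μω.IsUnitary) (ξ : OneDimAutRepH L), 
      ∀ (U₀ : Subgroup ↥(finAdelic (↥(maximalRealSubfield L)) L (IsCMField.complexConj L) 3 ((StdForm.antidiagonal 3).over L))) (_ : IsTauLevel L U₀)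
        (φ : (quasiSplit (↥(maximalRealSubfield L)) L (IsCMField.complexConj L) 3).Adelic → ℂ) (_ : φ ∈ chiSectionSpacePair (ξ.bcη⁻¹ * ξ.bcψ⁻¹ * μω) ξ.ψ (tauLevel L U₀) ((1 : ↥(tauLevel L U₀) →* ℂ) : ↥(tauLevel L U₀) → ℂ)) (_ : Continuous φ)
        (_ : IsArchFinite L φ)
        (Ec : ℂ → (quasiSplit (↥(maximalRealSubfield L)) L (IsCMField.complexConj L) 3).Adelic → ℂ), (∀ z : ℂ, 2 < z.re → Ec z = eisensteinSeriesU (flatSectionU φ z)) →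
        (∀ g, DifferentiableOn ℂ (fun z => Ec z g) ({z : ℂ | 1 < z.re} \ (↑({(3 : ℂ) / 2} : Finset ℂ) : Set ℂ))) →
        ∀ (Fp : (quasiSplit (↥(maximalRealSubfield L)) L (IsCMField.complexConj L) 3).Adelic → ℂ → ℂ), (∀ g, AnalyticAt ℂ (Fp g) ((3 : ℂ) / 2)) → (∀ g, Fp g =ᶠ[𝓝[≠] ((3 : ℂ) / 2)] fun z => (z - (3 : ℂ) / 2) * Ec z g) →
        ∃ f : (quasiSplit (↥(maximalRealSubfield L)) L (IsCMField.complexConj L) 3).L2 μ, (f : (quasiSplit (↥(maximalRealSubfield L)) L (IsCMField.complexConj L) 3).automorphicQuotient → ℂ) =ᵐ[μ] fun x => Fp (Quotient.out (x : (quasiSplit (↥(maximalRealSubfield L)) L (IsCMField.complexConj L) 3).Adelic ⧸ (quasiSplit (↥(maximalRealSubfield L)) L (IsCMField.complexConj L) 3).quotientSubgroup))⁻¹ ((3 : ℂ) / 2))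
    (hARCH : ∀ (L : Type) [Field L] [NumberField L] [IsCMField L]
      (μ : Measure (quasiSplit (↥(maximalRealSubfield L)) L (IsCMField.complexConj L) 3).automorphicQuotient) [(quasiSplit (↥(maximalRealSubfield L)) L (IsCMField.complexConj L) 3).IsAutomorphicMeasure μ]
      (μω : HeckeCharacter L) (_ : μω.IsUnitary) (ξ : OneDimAutRepH L), 
      ∀ (U₀ : Subgroup ↥(finAdelic (↥(maximalRealSubfield L)) L (IsCMField.complexConj L) 3 ((StdForm.antidiagonal 3).over L))), IsTauLevel L U₀ → ∀ f ∈ resGMidAtomGenτ L μ ξ μω U₀, ∀ a : ↥(arch (↥(maximalRealSubfield L)) L (IsCMField.complexConj L) 3 ((StdForm.antidiagonal 3).over L)),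
        ((quasiSplit (↥(maximalRealSubfield L)) L (IsCMField.complexConj L) 3).rightRegular μ) (archToAdelic (↥(maximalRealSubfield L)) L (IsCMField.complexConj L) 3 ((StdForm.antidiagonal 3).over L) a) f ∈ (Submodule.span ℂ (⋃ (U₀ : Subgroup ↥(finAdelic (↥(maximalRealSubfield L)) L (IsCMField.complexConj L) 3 ((StdForm.antidiagonal 3).over L))) (_ : IsTauLevel L U₀), resGMidAtomGenτ L μ ξ μω U₀)).topologicalClosure) :
    ∀ (L : Type) [Field L] [NumberField L] [IsCMField L]
      (μ : Measure (quasiSplit (↥(maximalRealSubfield L)) L (IsCMField.complexConj L) 3).automorphicQuotient) [(quasiSplit (↥(maximalRealSubfield L)) L (IsCMField.complexConj L) 3).IsAutomorphicMeasure μ]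
      (μω : HeckeCharacter L) (_ : μω.IsUnitary) (ξ : OneDimAutRepH L), ∀ (E : Submodule ℂ (resGMidBlock L μ ξ μω).toSubmodule)
          (hE : ∀ k, ∀ x ∈ E, ((resGMidBlock L μ ξ μω).toContRep.restrict (((standardMaximalCompactGL 3 L).comap (adelicVal (↥(maximalRealSubfield L)) L (IsCMField.complexConj L) 3 ((StdForm.antidiagonal 3).over L)) : Subgroup (quasiSplit (↥(maximalRealSubfield L)) L (IsCMField.complexConj L) 3).Adelic).subtype)) k x ∈ E), FiniteDimensional ℂ E →
          (((resGMidBlock L μ ξ μω).toContRep.restrict (((standardMaximalCompactGL 3 L).comap (adelicVal (↥(maximalRealSubfield L)) L (IsCMField.complexConj L) 3 ((StdForm.antidiagonal 3).over L)) : Subgroup (quasiSplit (↥(maximalRealSubfield L)) L (IsCMField.complexConj L) 3).Adelic).subtype)).subRep E hE).IsIrreducible →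
          FiniteDimensional ℂ (Representation.homRangeSum ((resGMidBlock L μ ξ μω).toContRep.restrict (((standardMaximalCompactGL 3 L).comap (adelicVal (↥(maximalRealSubfield L)) L (IsCMField.complexConj L) 3 ((StdForm.antidiagonal 3).over L)) : Subgroup (quasiSplit (↥(maximalRealSubfield L)) L (IsCMField.complexConj L) 3).Adelic).subtype)).toRepresentation (((resGMidBlock L μ ξ μω).toContRep.restrict (((standardMaximalCompactGL 3 L).comap (adelicVal (↥(maximalRealSubfield L)) L (IsCMField.complexConj L) 3 ((StdForm.antidiagonal 3).over L)) : Subgroup (quasiSplit (↥(maximalRealSubfield L)) L (IsCMField.complexConj L) 3).Adelic).subtype)).subRep E hE)) :=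
  hDISC_of_exports_of_arch hW1 (fun L _ _ _ μ _ μω hμu ξ => hEXI_of_rows L μ (hTEXPnf L μ μω hμu ξ) (hPL L μ μω hμu ξ) (hRES L μ μω hμu ξ)) hARCH

/-! ## §3 The exports row in normal form at the exports' frame, from the block letter (★ T head at the block) -/

/-- **`hTEXPnf` FROM THE BLOCK LETTER** (the frame and `hBLOCK` bytes of ★ `exportsTauRow_of_gauge_blocks`; `χ₂` automorphic): every τ-admissible generator lying in a finite-dimensional
`K_max`-stable block of continuous bounded pair-sections carrying row 1's gauge letters AT the block has the exports row IN NORMAL FORM — ★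
`chiEisenstein_meromorphic_exports_kfinite_cm_three_of_gauge_letters` at the block, keeping its `MeromorphicNFOn` clause. [cite: BernsteinLapid2019, Thm 2.3, §4, §7]
[cite: MoeglinWaldspurger1995, II.1.7, IV.1.8–IV.1.11] -/
theorem exportsTauRowNF_of_gauge_blocks
    [MeasurableSpace (quasiSplit (↥(maximalRealSubfield L)) L (IsCMField.complexConj L) 3).Adelic] [BorelSpace (quasiSplit (↥(maximalRealSubfield L)) L (IsCMField.complexConj L) 3).Adelic]
    (μ : Measure (quasiSplit (↥(maximalRealSubfield L)) L (IsCMField.complexConj L) 3).automorphicQuotient) [(quasiSplit (↥(maximalRealSubfield L)) L (IsCMField.complexConj L) 3).IsAutomorphicMeasure μ]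
    (νG : Measure (quasiSplit (↥(maximalRealSubfield L)) L (IsCMField.complexConj L) 3).Adelic) [νG.IsHaarMeasure] [νG.IsInvInvariant] [SFinite νG]
    (ν : Measure ↥(adelicUnipotent (↥(maximalRealSubfield L)) L (IsCMField.complexConj L) 3)) [ν.IsHaarMeasure] [ν.IsMulRightInvariant] [ν.IsInvInvariant]
    {𝓕 : Set ↥(adelicUnipotent (↥(maximalRealSubfield L)) L (IsCMField.complexConj L) 3)}
    (h𝓕N : IsFundamentalDomain ↥(rationalUnipotent (↥(maximalRealSubfield L)) L (IsCMField.complexConj L) 3) 𝓕 ν) (h𝓕c : IsCompact (closure 𝓕)) (h𝓕₀ : ν 𝓕 ≠ 0)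
    {β : (quasiSplit (↥(maximalRealSubfield L)) L (IsCMField.complexConj L) 3).Adelic → ℝ≥0∞}
    (hβ : IsCoveringWeight ↥((arithmeticBorel (↥(maximalRealSubfield L)) L (IsCMField.complexConj L) 3).map (quasiSplit (↥(maximalRealSubfield L)) L (IsCMField.complexConj L) 3).arithmeticSubgroup.subtype) β)
    {μZ : Measure (borelQuotient (↥(maximalRealSubfield L)) L (IsCMField.complexConj L) 3)} [SFinite μZ]
    (hμZ : ∀ f : borelQuotient (↥(maximalRealSubfield L)) L (IsCMField.complexConj L) 3 → ℝ≥0∞, Measurable f → ∫⁻ z, f z ∂μZ = ∫⁻ g, β g * f (toBorelQuotient (↥(maximalRealSubfield L)) L (IsCMField.complexConj L) 3 g) ∂νG)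
    {χ₁ : HeckeCharacter L} {χ₂ : ↥(TorusDict.torus (IsCMField.complexConj L)) →ₜ* ℂˣ} (hχ₂ : TorusDict.IsAutomorphic (IsCMField.complexConj L) χ₂)
    (hBLOCK : ∀ (U₀ : Subgroup ↥(finAdelic (↥(maximalRealSubfield L)) L (IsCMField.complexConj L) 3 ((StdForm.antidiagonal 3).over L))) (_ : IsTauLevel L U₀)
      (φ : (quasiSplit (↥(maximalRealSubfield L)) L (IsCMField.complexConj L) 3).Adelic → ℂ) (_ : φ ∈ chiSectionSpacePair χ₁ χ₂ (tauLevel L U₀) ((1 : ↥(tauLevel L U₀) →* ℂ) : ↥(tauLevel L U₀) → ℂ)) (_ : Continuous φ)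
      (_ : IsArchFinite L φ),
      ∃ V : Submodule ℂ ((quasiSplit (↥(maximalRealSubfield L)) L (IsCMField.complexConj L) 3).Adelic → ℂ), FiniteDimensional ℂ ↥V ∧ φ ∈ V ∧
        (∀ k ∈ ((standardMaximalCompactGL 3 L).comap (adelicVal (↥(maximalRealSubfield L)) L (IsCMField.complexConj L) 3 ((StdForm.antidiagonal 3).over L)) : Subgroup (quasiSplit (↥(maximalRealSubfield L)) L (IsCMField.complexConj L) 3).Adelic), ∀ ψ ∈ V, (fun x => ψ (x * k)) ∈ V) ∧
        (∀ ψ ∈ V, IsChiSectionPair χ₁ χ₂ ψ) ∧ (∀ ψ ∈ V, Continuous ψ) ∧ (∀ ψ ∈ V, ∃ M : ℝ, ∀ x, ‖ψ x‖ ≤ M) ∧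
        (∀ z₀ : ℂ, ∃ η : GL (Fin 3) (AdeleRing (𝓞 L) L) → ℝ, IsTestFunctionGL 3 L η ∧ (∀ g, 0 ≤ η g) ∧ (∀ g, η g⁻¹ = η g) ∧
      ∃ s : ℂ → ℂ, Differentiable ℂ s ∧ s z₀ ≠ 0 ∧ ∀ z : ℂ, ∀ φ ∈ V, ∀ x : (quasiSplit (↥(maximalRealSubfield L)) L (IsCMField.complexConj L) 3).Adelic, (∫ y, (fun y : (quasiSplit (↥(maximalRealSubfield L)) L (IsCMField.complexConj L) 3).Adelic => orbitalSmoothing νG (fun x : (quasiSplit (↥(maximalRealSubfield L)) L (IsCMField.complexConj L) 3).Adelic => ((η (adelicVal (↥(maximalRealSubfield L)) L (IsCMField.complexConj L) 3 ((StdForm.antidiagonal 3).over L) x) : ℝ) : ℂ)) (fun x : (quasiSplit (↥(maximalRealSubfield L)) L (IsCMField.complexConj L) 3).Adelic => ((η (adelicVal (↥(maximalRealSubfield L)) L (IsCMField.complexConj L) 3 ((StdForm.antidiagonal 3).over L) x) : ℝ) : ℂ)) y) y * flatSectionU φ z (x * y) ∂νG) = s z * flatSectionU φ z x) ∧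
        (∃ η : GL (Fin 3) (AdeleRing (𝓞 L) L) → ℝ, IsTestFunctionGL 3 L η ∧ (∀ g, 0 ≤ η g) ∧ (∀ g, η g⁻¹ = η g) ∧
      ∃ s : ℂ → ℂ, Differentiable ℂ s ∧ (∃ z₁ z₂ : ℂ, s z₁ ≠ s z₂) ∧ ∀ z : ℂ, ∀ φ ∈ V, ∀ x : (quasiSplit (↥(maximalRealSubfield L)) L (IsCMField.complexConj L) 3).Adelic, (∫ y, (fun y : (quasiSplit (↥(maximalRealSubfield L)) L (IsCMField.complexConj L) 3).Adelic => orbitalSmoothing νG (fun x : (quasiSplit (↥(maximalRealSubfield L)) L (IsCMField.complexConj L) 3).Adelic => ((η (adelicVal (↥(maximalRealSubfield L)) L (IsCMField.complexConj L) 3 ((StdForm.antidiagonal 3).over L) x) : ℝ) : ℂ)) (fun x : (quasiSplit (↥(maximalRealSubfield L)) L (IsCMField.complexConj L) 3).Adelic => ((η (adelicVal (↥(maximalRealSubfield L)) L (IsCMField.complexConj L) 3 ((StdForm.antidiagonal 3).over L) x) : ℝ) : ℂ)) y) y * flatSectionU φ z (x * y) ∂νG) = s z * flatSectionU φ z x))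 :
    ∀ (U₀ : Subgroup ↥(finAdelic (↥(maximalRealSubfield L)) L (IsCMField.complexConj L) 3 ((StdForm.antidiagonal 3).over L))) (_ : IsTauLevel L U₀)
      (φ : (quasiSplit (↥(maximalRealSubfield L)) L (IsCMField.complexConj L) 3).Adelic → ℂ) (_ : φ ∈ chiSectionSpacePair χ₁ χ₂ (tauLevel L U₀) ((1 : ↥(tauLevel L U₀) →* ℂ) : ↥(tauLevel L U₀) → ℂ)) (_ : Continuous φ)
      (_ : IsArchFinite L φ),
      ∃ (Ec' : ℂ → (quasiSplit (↥(maximalRealSubfield L)) L (IsCMField.complexConj L) 3).Adelic → ℂ) (P : Set ℂ), (∀ g, MeromorphicNFOn (fun z => Ec' z g) univ) ∧ IsClosed P ∧ (∀ z₀ : ℂ, ∀ᶠ s in 𝓝[≠] z₀, s ∉ P) ∧ (∀ z ∈ P, z.re ≤ 2) ∧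
        (∀ z : ℂ, 2 < z.re → Ec' z = eisensteinSeriesU (flatSectionU φ z)) ∧ (∀ g (z : ℂ), z ∉ P → AnalyticAt ℂ (fun z => Ec' z g) z) ∧
        (∀ z : ℂ, z ∉ P → Continuous (Ec' z)) ∧
        (∀ z₁ : ℂ, z₁ ∉ P → ∀ K : Set (quasiSplit (↥(maximalRealSubfield L)) L (IsCMField.complexConj L) 3).Adelic, IsCompact K → ∃ V ∈ 𝓝 z₁, ∃ M : ℝ, ∀ z ∈ V, ∀ g ∈ K, ‖Ec' z g‖ ≤ M) := by
  intro U₀ hU₀ φ hφV hφc hfin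
  obtain ⟨V, hVfd, hφ, hVK, hVχ, hVc, hVM, hfam, hnc⟩ := hBLOCK U₀ hU₀ φ hφV hφc hfin
  haveI := hVfd
  obtain ⟨n, φ', q, Ec, qc, P, -, -, -, -, -, -, hEnf, -, hEcE, -, hPc, hPcd, hPre, hEan, -, -, -, hEcont, hEbd⟩ :=
    chiEisenstein_meromorphic_exports_kfinite_cm_three_of_gauge_letters L μ νG ν h𝓕N h𝓕c h𝓕₀ hβ hμZ hχ₂ V hVK hVχ hVc hVM hfam hnc hφ
  exact ⟨Ec, P, hEnf, hPc, hPcd, hPre, hEcE, hEan, hEcont, hEbd⟩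

end Summit.HodgeConjecture.HodgeConjecture.R90.S8

end
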